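import Summits.QuantumFields.QCD.Theses.PauliWegnerSea

/-!
# QuantumFields / QCD — route `PauliWegnerSea`, the assembly `Assembly` (stmt-QuantumFields-11517)

Route `QCD/PauliWegnerSea` (Wegner estimate for the Wilson–Dirac sea), item stmt-QuantumFields-11517
(`Assembly`, rank 1):

  `FibreCofactorDomination ∧ FMClosureUnquenched ∧ TiltedFlatness ∧ OneScaleTrajectory ∧
   PhaseQuenchedFlavourDecay ∧ GluonicCompletion → QCD`.

This is the uncurried form of the route file's kernel-checked deciding theorem
`Summit.QuantumFields.QCD.Theses.PauliWegnerSea.closes` (D-0027 §2.1), whose six hypotheses are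
exactly the six conjuncts, in the same order, and whose conclusion is the sub-problem constant
`_root_.QCD` of `Summits/QuantumFields/QCD/Statement.lean`.  The assembly therefore closes by
destructuring the conjunction and applying `closes`; no mathematics beyond the route's own glue
(for `N_f ∈ {2, 3}`: `OneScaleTrajectory` supplies the regularisation and the per-mass clauses
(i), (iii), (iv) and the fractional-moment input; `FMClosureUnquenched` fed with
`FibreCofactorDomination` and `TiltedFlatness` upgrades that input to clause (ii);
`PhaseQuenchedFlavourDecay` turns (ii) into the flavour-charged decay; `GluonicCompletion`
converts the package into `QCDOf N_f`).

Design note: this module imports the Theses module (the statement is cited BY NAME, as the gate's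
closing probe requires), so the gate records the closure as the docstring link
`proved by … (prover)` in the route file rather than as an in-file `Assembly_holds` theorem
(a re-import would be an import cycle; `docs/reference/gate.md` §4.2).

References: A. Jaffe, E. Witten, *Quantum Yang–Mills theory* (Clay problem description, 2000);
M. Aizenman, A. Elgart, S. Naboko, J. Schenker, G. Stolz, *Moment analysis for localization in
random Schrödinger operators* (2001/2006); M. Golterman, Y. Shamir, Phys. Rev. D 68 (2003) 074501.

**Maintenance record (full-build repair 2026-08-17, statement and name unchanged).** The route repair of
2026-08-16T23:21Z (rev 6/7, after the statement re-type p117723 added `reg.IsChiralAtZero` to `QCDOf`)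
re-typed the deciding theorem `closes` over the chiral cruxes `ChiralOneScaleTrajectory` /
`ChiralGluonicCompletion`, while this (closed) assembly item stmt-QuantumFields-11517 keeps
`OneScaleTrajectory` / `GluonicCompletion`; so `closes h₁ … h₆` stopped fitting ("44:71: Application
type mismatch"). As the planner's rev-7 note in the route file prescribes, the rev-0–5 eight-line body of
`closes` is now inlined below (`GluonicCompletion` concludes `QCDOf N_f` by name, so it absorbs the new
conjunct): for `N_f ∈ {2, 3}`, `OneScaleTrajectory` gives `reg` with mass scaling, asymptotic scaling
and the per-mass clauses; `FMClosureUnquenched` fed `FibreCofactorDomination`, `TiltedFlatness` and the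
one-scale input gives clause (ii); `PhaseQuenchedFlavourDecay` the flavour-charged decay;
`GluonicCompletion` the sub-problem constant; `QCD = QCDOf 2 ∧ QCDOf 3`.
-/

namespace Summit.QuantumFields.QCD.Theorems

/-- **Assembly of route `PauliWegnerSea`** (item stmt-QuantumFields-11517):
`FibreCofactorDomination ∧ FMClosureUnquenched ∧ TiltedFlatness ∧ OneScaleTrajectory ∧
PhaseQuenchedFlavourDecay ∧ GluonicCompletion → QCD`.  Pure logic: the statement is the uncurried
type of the route's proved deciding theorem `Theses.PauliWegnerSea.closes`; destructure the
six-fold conjunction and run its (rev-0–5) body — inlined since the 2026-08-17 repair, see the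
maintenance record. [folklore] -/
theorem pauliWegnerSea_assembly_proof :
    Summit.QuantumFields.QCD.Theses.PauliWegnerSea.Assembly := by
  unfold Summit.QuantumFields.QCD.Theses.PauliWegnerSea.Assembly
  rintro ⟨h₁, h₂, h₃, h₄, h₅, h₆⟩
  -- the rev-0–5 body of `Theses.PauliWegnerSea.closes`, inlined (maintenance record)
  have key : ∀ Nf : ℕ, Nf = 2 ∨ Nf = 3 → QCDOf Nf := by
    intro Nf hNf
    obtain ⟨reg, hMS, hAS, h⟩ := h₄ Nf hNf
    refine h₆ Nf hNf ⟨reg, hMS, hAS, fun m hm => ?_⟩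
    obtain ⟨hi, hin, hiii, hiv⟩ := h m hm
    have hii := h₂ h₁ h₃ Nf reg m hm hin
    exact ⟨⟨hi, hii, hiii, hiv⟩, h₅ Nf reg m hm hii⟩
  exact ⟨key 2 (Or.inl rfl), key 3 (Or.inr rfl)⟩

end Summit.QuantumFields.QCD.Theorems
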